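import Summits.ResolutionOfSingularities.ResolutionOfSingularities.Theorems.FrobeniusClosingPatchingRelPerfectMonomialRouteKChartTransforms
import Summits.ResolutionOfSingularities.ResolutionOfSingularities.Theorems.FrobeniusClosingPatchingRelPerfectMonomialPolyhedraGameBlock
import Literature.AlgebraicGeometry.Resolution.BlowupSequencesRestrictMarked
import HarnessLib

/-!
# Crux `PatchingRelPerfect` (stmt-ResolutionOfSingularities-16161), chain w52 — TargetsF3 (m)
# «M2-strong», COMBINATORIAL HALF, Route K step K13: the DATA of the next level of the tower and its
# chart readings

[OURS · L1 W5.2 · design memo v3 (`L/res-type-075/M2STRONG-COMBINATORIAL-HALF.md`); fact-free;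
nothing here is a statement of the manuscript under review]

Given the invariant `Good L m s Y D M (C :: rest) 𝒞` (file K9) and a block play `mv` of the components of
the head centre `C` (files K9/K10), the next level is `Y' = Bl_C Y` with

* `newD` — the new boundary: strict transforms of the old divisors, and for each move `(J, e)` the
  exceptional piece over `E_J` (the pull-back of the stratum ideal `⨆_{l ∈ J} D l`) labelled `e`;
* `newCharts` — the new atlas: over a chart reading `C` as `(x_S)` the charts of file K11's family
  (one for each `j ∈ S`, variable `j` relabelled by the exceptional name), over a chart missing `C` its
  lift;

together with the first readings: `Chart.ofMap_mem_support_iff` (support membership at a point `g z` of a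
chart defined by an open immersion `g`), `newD_of_mem` / `newD_of_blockPlay` / `newD_of_forall_ne`, and
a chart reads the stratum ideal of its seen component as `(x_S)` (`Good.img_stratumIdeal_labels`) and a
stratum not inside its cone as `⊤`.  The fields of `Good` at the next level are proved in the next files.
-/

-- `Summit.<Summit>.<Sub>.Theorems` with `Sub = Summit` (single-conjunct summit, D-0017)
set_option linter.dupNamespace false

noncomputable section

open CategoryTheory AlgebraicGeometry TopologicalSpace MvPolynomial
open Literature.AlgebraicGeometry.Resolution

namespace Summit.ResolutionOfSingularities.ResolutionOfSingularities.Theorems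

namespace PolyhedraGame

/-! ## Block plays enumerate the family -/

/-- [OURS] A block play plays every member of the family. -/
theorem BlockPlay.exists_mem {m : ℕ} : ∀ {s : State} {𝒥 : Finset (Finset ℕ)} {mv : List (Finset ℕ × ℕ)},
    BlockPlay m s 𝒥 mv → ∀ J ∈ 𝒥, ∃ e, (J, e) ∈ mv
  | s, 𝒥, [], h, J, hJ => by
    rw [blockPlay_nil] at h; subst h; exact absurd hJ (Finset.notMem_empty J)
  | s, 𝒥, (J₀, e₀) :: mv, h, J, hJ => by
    obtain ⟨hJ₀, -, hrest⟩ := (blockPlay_cons m s 𝒥 J₀ e₀ mv).mp h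
    by_cases hJJ : J = J₀
    · subst hJJ; exact ⟨e₀, List.mem_cons_self⟩
    · obtain ⟨e, he⟩ := BlockPlay.exists_mem hrest J (Finset.mem_erase.mpr ⟨hJJ, hJ⟩)
      exact ⟨e, List.mem_cons_of_mem _ he⟩

/-- [OURS] In a block play the members played are pairwise distinct: two moves with the same name are
the same move, and two moves at the same member are the same move. -/
theorem BlockPlay.eq_of_snd_eq {m : ℕ} : ∀ {s : State} {𝒥 : Finset (Finset ℕ)} {mv : List (Finset ℕ × ℕ)},
    BlockPlay m s 𝒥 mv → ∀ p ∈ mv, ∀ q ∈ mv, p.2 = q.2 → p = q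
  | s, 𝒥, [], _, p, hp, _, _, _ => absurd hp List.not_mem_nil
  | s, 𝒥, (J₀, e₀) :: mv, h, p, hp, q, hq, hpq => by
    obtain ⟨-, he₀, hrest⟩ := (blockPlay_cons m s 𝒥 J₀ e₀ mv).mp h
    have hfresh := (BlockPlay.fresh hrest).1
    have he₀' : ∀ q ∈ mv, q.2 ≠ e₀ := fun q hq h =>
      (hfresh q hq).2 (by rw [h]; exact Finset.mem_insert_self e₀ s.B)
    rcases List.mem_cons.mp hp with rfl | hp <;> rcases List.mem_cons.mp hq with rfl | hq
    · rfl
    · exact absurd hpq.symm (he₀' q hq)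
    · exact absurd hpq (he₀' p hp)
    · exact BlockPlay.eq_of_snd_eq hrest p hp q hq hpq

/-- [OURS] Two moves of a block play at the same member are the same move. -/
theorem BlockPlay.eq_of_fst_eq {m : ℕ} : ∀ {s : State} {𝒥 : Finset (Finset ℕ)} {mv : List (Finset ℕ × ℕ)},
    BlockPlay m s 𝒥 mv → ∀ p ∈ mv, ∀ q ∈ mv, p.1 = q.1 → p = q
  | s, 𝒥, [], _, p, hp, _, _, _ => absurd hp List.not_mem_nil
  | s, 𝒥, (J₀, e₀) :: mv, h, p, hp, q, hq, hpq => by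
    obtain ⟨-, -, hrest⟩ := (blockPlay_cons m s 𝒥 J₀ e₀ mv).mp h
    have hfresh := (BlockPlay.fresh hrest).1
    have hJ₀' : ∀ q ∈ mv, q.1 ≠ J₀ := fun q hq h =>
      Finset.notMem_erase J₀ 𝒥 (h ▸ (hfresh q hq).1)
    rcases List.mem_cons.mp hp with rfl | hp <;> rcases List.mem_cons.mp hq with rfl | hq
    · rfl
    · exact absurd hpq.symm (hJ₀' q hq)
    · exact absurd hpq (hJ₀' p hp)
    · exact BlockPlay.eq_of_fst_eq hrest p hp q hq hpq

namespace RouteK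

variable {L : Finset ℕ}

/-! ## Points of a chart given by an open immersion -/

namespace Chart

variable {Y' : Scheme.{0}}

/-- [OURS] **Support membership at a point `g z` of a chart `ofMap lab g`**: `g z ∈ supp K` iff the chart
image of `K` lies in the prime `z`. -/
theorem ofMap_mem_support_iff (lab : ℕ → ℕ) (g : Spec (Rc L) ⟶ Y') [IsOpenImmersion g]
    (K : Y'.IdealSheafData) (z : Spec (Rc L)) :
    g z ∈ K.support ↔ (ofMap lab g).img K ≤ z.asIdeal := by
  -- through `z = g⁻¹(g z)`: `g z ∈ supp K ↔ z ∈ supp (g^* K)`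
  have h1 : g z ∈ K.support ↔ z ∈ (K.comap g).support := by
    rw [Scheme.IdealSheafData.support_comap]; rfl
  -- sections of `g^* K` on `⊤` are `K(g(⊤))` along `appIso`
  have hsec : (K.comap g).ideal ⟨⊤, isAffineOpen_top _⟩ = (K.ideal (ofMap lab g).U).map (g.appLE (g ''ᵁ ⊤) ⊤
      (Scheme.Hom.preimage_image_eq g ⊤).ge).hom :=
    ideal_comap_of_le g K (ofMap lab g).U ⟨⊤, isAffineOpen_top _⟩ _
  have happ : g.appLE (g ''ᵁ ⊤) ⊤ (Scheme.Hom.preimage_image_eq g ⊤).ge = (g.appIso ⊤).hom :=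
    (Scheme.Hom.appIso_hom' g ⊤).symm
  have himg : (ofMap lab g).img K =
      ((K.ideal (ofMap lab g).U).map (g.appIso ⊤).hom.hom).map (Scheme.ΓSpecIso (Rc L)).hom.hom := by
    have hcoe : ((ofMap lab g).e : Γ(Y', (ofMap lab g).U) →+* MvPolynomial L ℚ) =
        (Scheme.ΓSpecIso (Rc L)).hom.hom.comp (g.appIso ⊤).hom.hom := RingHom.ext fun _ => rfl
    unfold Chart.img
    rw [hcoe]
    exact (Ideal.map_map _ _).symm
  rw [h1, Scheme.IdealSheafData.mem_support_iff_of_mem (I := K.comap g) (U := ⟨⊤, isAffineOpen_top _⟩)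
    (Opens.mem_top z), Scheme.mem_zeroLocus_iff, hsec, happ, himg, Ideal.map_le_iff_le_comap]
  constructor
  · intro h f hf
    have := h f hf
    rw [show f = (Scheme.ΓSpecIso (Rc L)).inv ((Scheme.ΓSpecIso (Rc L)).hom f) from
      (Iso.hom_inv_id_apply _ f).symm, basicOpen_eq_of_affine] at this
    exact not_not.mp this
  · intro h f hf
    rw [show f = (Scheme.ΓSpecIso (Rc L)).inv ((Scheme.ΓSpecIso (Rc L)).hom f) from
      (Iso.hom_inv_id_apply _ f).symm, basicOpen_eq_of_affine]
    exact not_not.mpr (h hf)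

end Chart

/-! ## The data of the next level -/

section StepData

variable {Y : Scheme.{0}}

/-- [OURS] The ideal of the stratum `E_J = ⋂_{l ∈ J} D_l`: `⨆_{l ∈ J} D l`. -/
def stratumIdeal (D : ℕ → Y.IdealSheafData) (J : Finset ℕ) : Y.IdealSheafData := ⨆ l : (J : Set ℕ), D l

/-- [OURS] A stratum ideal read in a chart. -/
theorem Chart.img_stratumIdeal (c : Chart L Y) (D : ℕ → Y.IdealSheafData) (J : Finset ℕ) :
    c.img (stratumIdeal D J) = ⨆ l : (J : Set ℕ), c.img (D l) :=
  c.img_iSup _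

/-- [OURS · Route K] **The new boundary** on `Bl_C Y` after the block play `mv`: strict transforms of the
old divisors; for a move `(J, e)` the exceptional piece over `E_J`, labelled `e`; the unit ideal sheaf
at all other indices. -/
def newD (s : State) (D : ℕ → Y.IdealSheafData) (C : Y.IdealSheafData) (mv : List (Finset ℕ × ℕ)) (l : ℕ) :
    (blowup C).IdealSheafData :=
  if l ∈ s.B then strictTransformIdeal (blowup.π C) C (D l)
  else ⨅ p : {p : Finset ℕ × ℕ // p ∈ mv ∧ p.2 = l}, (stratumIdeal D p.1.1).comap (blowup.π C)

/-- [OURS] The new boundary at an old index. -/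
theorem newD_of_mem {s : State} (D : ℕ → Y.IdealSheafData) (C : Y.IdealSheafData) (mv : List (Finset ℕ × ℕ))
    {l : ℕ} (hl : l ∈ s.B) : newD s D C mv l = strictTransformIdeal (blowup.π C) C (D l) := by
  simp [newD, hl]

/-- [OURS] The new boundary at an index which is neither old nor a name of the block. -/
theorem newD_of_forall_ne {s : State} (D : ℕ → Y.IdealSheafData) (C : Y.IdealSheafData)
    (mv : List (Finset ℕ × ℕ)) {l : ℕ} (hl : l ∉ s.B) (hne : ∀ p ∈ mv, p.2 ≠ l) : newD s D C mv l = ⊤ := by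
  rw [newD, if_neg hl]
  haveI : IsEmpty {p : Finset ℕ × ℕ // p ∈ mv ∧ p.2 = l} := ⟨fun p => hne p.1 p.2.1 p.2.2⟩
  exact iInf_of_empty _

/-- [OURS] The new boundary at the name of a move: the exceptional piece over the move's centre. -/
theorem newD_of_blockPlay {m : ℕ} {s : State} {𝒥 : Finset (Finset ℕ)} (D : ℕ → Y.IdealSheafData)
    (C : Y.IdealSheafData) {mv : List (Finset ℕ × ℕ)} (hmv : BlockPlay m s 𝒥 mv) {J : Finset ℕ} {e : ℕ}
    (hJe : (J, e) ∈ mv) : newD s D C mv e = (stratumIdeal D J).comap (blowup.π C) := by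
  have he : e ∉ s.B := ((BlockPlay.fresh hmv).1 (J, e) hJe).2
  rw [newD, if_neg he]
  haveI : Nonempty {p : Finset ℕ × ℕ // p ∈ mv ∧ p.2 = e} := ⟨⟨(J, e), hJe, rfl⟩⟩
  have hall : ∀ p : {p : Finset ℕ × ℕ // p ∈ mv ∧ p.2 = e}, p.1 = (J, e) := fun p =>
    BlockPlay.eq_of_snd_eq hmv p.1 p.2.1 (J, e) hJe p.2.2
  apply le_antisymm
  · exact iInf_le_of_le ⟨(J, e), hJe, rfl⟩ le_rfl
  · exact le_iInf fun p => by rw [hall p]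

variable {C : Y.IdealSheafData}

/-- [OURS] The chart maps of file K11 over a chart reading the centre as `(x_S)` (a choice). -/
def famMap (c : Chart L Y) (S : Finset L) (hS : c.img C = coordIdeal S) : S → (Spec (Rc L) ⟶ blowup C) :=
  Classical.choose (exists_chartFamily c (blowup.isBlowup C) S hS)

/-- [OURS] The properties of the chosen chart maps (file K11 `exists_chartFamily`). -/
theorem famMap_spec (c : Chart L Y) (S : Finset L) (hS : c.img C = coordIdeal S) :
    (∀ j, IsOpenImmersion (famMap c S hS j)) ∧
      (∀ j, famMap c S hS j ≫ blowup.π C = Spec.map (CommRingCat.ofHom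
        ((coordBlowupSubst ℚ (S : Set L) (j : L)).toRingHom.comp (c.e : Γ(Y, c.U) →+* MvPolynomial L ℚ))) ≫
          c.U.2.fromSpec) ∧
      (∀ y' : blowup C, blowup.π C y' ∈ (c.U : Y.Opens) → ∃ j, y' ∈ Set.range (famMap c S hS j)) ∧
      (∀ (i j : S) (z : Spec (Rc L)), (MvPolynomial.X (j : L) : MvPolynomial L ℚ) ∉ z.asIdeal →
        famMap c S hS i z ∈ Set.range (famMap c S hS j)) :=
  Classical.choose_spec (exists_chartFamily c (blowup.isBlowup C) S hS)

/-- [OURS] The lifted chart map of file K11 over a chart missing the centre (a choice). -/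
def liftMap (c : Chart L Y) (htop : c.img C = ⊤) : Spec (Rc L) ⟶ blowup C :=
  Classical.choose (exists_liftChart c (blowup.isBlowup C) htop)

/-- [OURS] The properties of the chosen lifted chart map (file K11 `exists_liftChart`). -/
theorem liftMap_spec (c : Chart L Y) (htop : c.img C = ⊤) :
    IsOpenImmersion (liftMap c htop) ∧
      liftMap c htop ≫ blowup.π C = Spec.map (CommRingCat.ofHom
        ((RingHom.id _).comp (c.e : Γ(Y, c.U) →+* MvPolynomial L ℚ))) ≫ c.U.2.fromSpec ∧
      ∀ y' : blowup C, blowup.π C y' ∈ (c.U : Y.Opens) → y' ∈ Set.range (liftMap c htop) :=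
  Classical.choose_spec (exists_liftChart c (blowup.isBlowup C) htop)

/-- [OURS · Route K] The new chart over `c` for the variable `j ∈ S` and the exceptional name `e`. -/
def famChart (c : Chart L Y) (S : Finset L) (hS : c.img C = coordIdeal S) (j : S) (e : ℕ) : Chart L (blowup C) :=
  @Chart.ofMap L (blowup C) (Function.update c.lab j e) (famMap c S hS j) ((famMap_spec c S hS).1 j)

/-- [OURS · Route K] The lifted chart over a chart missing the centre. -/
def liftChart (c : Chart L Y) (htop : c.img C = ⊤) : Chart L (blowup C) :=
  @Chart.ofMap L (blowup C) c.lab (liftMap c htop) (liftMap_spec c htop).1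

/-- [OURS · Route K] **The new atlas** on `Bl_C Y` after the block play `mv` of the components. -/
def newCharts (𝒞 : Set (Chart L Y)) (C : Y.IdealSheafData) (mv : List (Finset ℕ × ℕ)) : Set (Chart L (blowup C)) :=
  {c' | ∃ c ∈ 𝒞, ∃ (S : Finset L) (hS : c.img C = coordIdeal S) (j : S) (e : ℕ),
      (c.labels S, e) ∈ mv ∧ c' = famChart c S hS j e} ∪
  {c' | ∃ c ∈ 𝒞, ∃ htop : c.img C = ⊤, c' = liftChart c htop}

/-! ## Readings in the new charts -/

variable {m : ℕ} {s : State} {D : ℕ → Y.IdealSheafData} {M : MarkedIdeal Y} {rest : CentreSeq (blowup C)}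
  {𝒞 : Set (Chart L Y)} (G : Good L m s Y D M (CentreSeq.cons C rest) 𝒞)
include G

/-- [OURS] A chart seeing `S` reads the stratum ideal of its labels as `(x_S)`. -/
theorem Good.img_stratumIdeal_labels [DecidableEq L] {c : Chart L Y} (hc : c ∈ 𝒞) (S : Finset L) :
    c.img (stratumIdeal D (c.labels S)) = coordIdeal S := by
  rw [Chart.img_stratumIdeal]
  apply le_antisymm
  · refine iSup_le fun l => ?_
    obtain ⟨b, hb, hl⟩ := Finset.mem_image.mp (Finset.mem_coe.mp l.2)
    rw [← hl, G.img_D c hc b, Ideal.span_singleton_le_iff_mem]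
    exact X_mem_coordIdeal hb
  · unfold coordIdeal
    rw [Ideal.span_le]
    rintro _ ⟨b, hb, rfl⟩
    have hl : c.lab b ∈ (c.labels S : Set ℕ) := Finset.mem_coe.mpr (Finset.mem_image_of_mem _ (Finset.mem_coe.mp hb))
    refine (le_iSup (fun l : (c.labels S : Set ℕ) => c.img (D l)) ⟨c.lab b, hl⟩) ?_
    change MvPolynomial.X b ∈ c.img (D (c.lab b))
    rw [G.img_D c hc b]
    exact Ideal.mem_span_singleton_self _

/-- [OURS] A chart whose cone misses a label of `J` reads the stratum ideal of `J` as `⊤`. -/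
theorem Good.img_stratumIdeal_eq_top {c : Chart L Y} (hc : c ∈ 𝒞) {J : Finset ℕ} {l : ℕ} (hlJ : l ∈ J)
    (hl : l ∉ c.cone) : c.img (stratumIdeal D J) = ⊤ := by
  rw [Chart.img_stratumIdeal]
  exact top_le_iff.mp (le_iSup_of_le ⟨l, Finset.mem_coe.mpr hlJ⟩ (G.img_D_top c hc l hl).ge)

end StepData

end RouteK

end PolyhedraGame

end Summit.ResolutionOfSingularities.ResolutionOfSingularities.Theorems

end
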